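import Summits.BirchSwinnertonDyer.BirchSwinnertonDyer.Theorems.GenusKolyvaginAtTwoPowDvdShaCardAtTwoRTGenusParity
import HarnessLib

/-!
# Route `GenusKolyvaginAtTwo`, crux U₂ `MinimalTwinBSDTwo` (stmt-BirchSwinnertonDyer-22985) and the supply cruxes: THE GENUS PARITY LAW
# WITHOUT THE ODD-TAMAGAWA HYPOTHESIS — `(−1)^{ord₂ C(Wd)} = (−1)^{ord₂ C(W)} · sign Δ_min(W)` — hence on `Δ < 0` a Heegner twin is NEVER
# all-silent and on `Δ > 0` NEVER costs exactly one bit, whatever `C(W)` is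

Seat `bsd-line-gk2-p3` g28 (PROVER seat 3/3, cell `bsd-f1-sign2`), `--supports stmt-BirchSwinnertonDyer-22985` (helper; closes nothing).
THEOREMS ONLY (no definition, no named fact, no `sorry`); standard axioms; everything UNCONDITIONAL.  **BSD is NOT proved by this file; nothing
is closed.**

WHY.  gk2-p2 g17 / gk2-p3's genus parity law `PlusDescent.neg_one_pow_padicValNat_two_tamagawaProduct_twin` (`(−1)^{ord₂ C(Wd)} = sign Δ_min`)
carries `Odd C(W)`; like the budget lemmas (this seat's `…SwappedPairOneBit` §1, p766610) the hypothesis enters only through the conversion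
`ord₂ C(Wd) = Σ_q ord₂(1 + #roots_q)`, whose hT-free form is the tree's `padicValNat_two_tamagawaProduct_twin_eq`
(`ord₂ C(Wd) = ord₂ C(W) + Σ_q …`).  The hT-free law sorts this seat's swapped engines by sign: the ONE-BIT engine (p766610/p766822/p767140,
`ord₂ C(Wd) = ord₂ C(W) + 1`) can only fire on `Δ < 0`, the ALL-SILENT engine (p767255 / `…SilentDescent`, `ord₂ C(Wd) = ord₂ C(W)`) only on
`Δ > 0` — matching the cells `hTw1 = (Δ < 0, ord₂ C = 1)` and `hTw0/hTw2 = (Δ > 0, ord₂ C ∈ {0, 2})` that `closes` (and LINE 24) consume.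

* §1 **`neg_one_pow_padicValNat_two_tamagawaProduct_twin_eq_mul_sign`** — `W` globally minimal (ANY `C(W)`), `K` imaginary quadratic with odd
  `d_K`, Heegner for `N_W`, `Wd = Cd • W^(d_K)` any elliptic model: **`(−1)^{ord₂ C(Wd)} = (−1)^{ord₂ C(W)} · sign Δ_min(W)`**.
* §2 `odd_padicValNat_add_of_Δ_neg` / `even_padicValNat_add_of_Δ_pos` — the bit count `ord₂ C(Wd) − ord₂ C(W)` is ODD on `Δ < 0`, EVEN on
  `Δ > 0`; `padicValNat_twin_ne_of_Δ_neg` (no all-silent twin on `Δ < 0`), `padicValNat_twin_ne_succ_of_Δ_pos` (no one-bit twin on `Δ > 0`).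

References: [Kramer1981] §2 Prop. 3; [IrelandRosen1990] Prop. 5.2.2; [GrossLMS1991] §1; [BoxerDiao2010] proof of Prop. 4.1.
-/

set_option autoImplicit false
set_option linter.dupNamespace false -- `Summit.<P>.<Sub>` repeats `BirchSwinnertonDyer` (D-0017)

noncomputable section

open scoped Classical

namespace Summit.BirchSwinnertonDyer.BirchSwinnertonDyer.Theorems.GenusExact.PlusDescent.BudgetParity

open WeierstrassCurve NumberField Literature.NumberTheory.EllipticCurves
open Summit.BirchSwinnertonDyer.BirchSwinnertonDyer.Theorems.GenusExact.PlusDescent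

variable (W : WeierstrassCurve ℚ) [W.IsElliptic] [W.IsGloballyMinimal]
  {K : Type} [Field K] [NumberField K]

/-! ## §1 The parity law for any `C(W)` -/

/-- **`(−1)^{ord₂ C(Wd)} = (−1)^{ord₂ C(W)} · sign Δ_min(W)`** for `W/ℚ` globally minimal (ANY Tamagawa product), `K` imaginary quadratic
with odd `d_K` satisfying the Heegner hypothesis for `N_W`, `Wd = Cd • W^(d_K)` any elliptic model of the twist: the hT-free valuation
`ord₂ C(Wd) = ord₂ C(W) + Σ_{q∣d_K} ord₂(1 + #roots_q)`, the per-prime sign `(−1)^{ord₂(1+#roots_q)} = (Δ_min/q)`, `|d_K|` square-free and the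
reciprocity `J(Δ_min | |d_K|) = sign Δ_min`.  Generalises `neg_one_pow_padicValNat_two_tamagawaProduct_twin` (the case `C(W)` odd).
[cite: Kramer1981, §2 Prop. 3] [cite: IrelandRosen1990, Prop. 5.2.2] -/
theorem neg_one_pow_padicValNat_two_tamagawaProduct_twin_eq_mul_sign (hK : IsImaginaryQuadratic K)
    (hodd : Odd (NumberField.discr K)) (hH : SatisfiesHeegnerHypothesis (W.conductorNorm ℤ) K)
    {Wd : WeierstrassCurve ℚ} [Wd.IsElliptic] (Cd : VariableChange ℚ)
    (hWd : Cd • W.quadraticTwist (NumberField.discr K : ℚ) = Wd) :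
    (-1 : ℤ) ^ padicValNat 2 Wd.tamagawaProduct = (-1) ^ padicValNat 2 W.tamagawaProduct * (minimalDiscriminantInt W).sign := by
  have hfact2 : Fact (Nat.Prime 2) := ⟨Nat.prime_two⟩
  rw [padicValNat_two_tamagawaProduct_twin_eq W hK hodd hH Cd hWd, pow_add, ← Finset.prod_pow_eq_pow_sum,
    ← GenusKolyTwin.jacobiSym_minimalDiscriminantInt_natAbs_discr W hK hodd hH,
    jacobiSym_eq_prod_primeFactors _ (squarefree_natAbs_discr_of_odd hK.1 hodd)]
  congr 1
  refine Finset.prod_congr rfl fun q hq ↦ ?_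
  obtain ⟨hqP, hqdvd, -⟩ := Nat.mem_primeFactors.mp hq
  have hqd : (q : ℤ) ∣ NumberField.discr K := Int.natCast_dvd.mpr hqdvd
  haveI := Fact.mk hqP
  have hq2 : q ≠ 2 := by
    rintro rfl
    exact (Int.not_even_iff_odd.mpr hodd) (even_iff_two_dvd.mpr (by exact_mod_cast hqd))
  have hqΔ : ¬ (q : ℤ) ∣ minimalDiscriminantInt W :=
    not_dvd_minimalDiscriminantInt_of_dvd_discr_of_heegner W K hK.1 hH hqP hq2 hqd
  exact neg_one_pow_padicValNat_card_roots_add_one_eq_jacobiSym W hq2 hqΔ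

/-! ## §2 Consequences by the sign of `Δ` -/

/-- **`Δ_W < 0 ⇒ ord₂ C(Wd) + ord₂ C(W)` is ODD** (so the bit count `ord₂ C(Wd) − ord₂ C(W)` is odd: at least one transposition prime),
for any `C(W)`.  [cite: Kramer1981, §2 Prop. 3] [cite: IrelandRosen1990, Prop. 5.2.2] -/
theorem odd_padicValNat_add_of_Δ_neg (hK : IsImaginaryQuadratic K)
    (hodd : Odd (NumberField.discr K)) (hH : SatisfiesHeegnerHypothesis (W.conductorNorm ℤ) K) (hΔ : W.Δ < 0)
    {Wd : WeierstrassCurve ℚ} [Wd.IsElliptic] (Cd : VariableChange ℚ)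
    (hWd : Cd • W.quadraticTwist (NumberField.discr K : ℚ) = Wd) :
    Odd (padicValNat 2 Wd.tamagawaProduct + padicValNat 2 W.tamagawaProduct) := by
  have h := neg_one_pow_padicValNat_two_tamagawaProduct_twin_eq_mul_sign W hK hodd hH Cd hWd
  rw [(GenusKolyTwin.sign_minimalDiscriminantInt_eq_neg_one_iff W).mpr hΔ, mul_neg_one] at h
  -- `(-1)^a = -(-1)^b`, so `(-1)^(a+b) = -((-1)^b)^2 = -1`
  have h2 : (-1 : ℤ) ^ (padicValNat 2 Wd.tamagawaProduct + padicValNat 2 W.tamagawaProduct) = -1 := by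
    rw [pow_add, h, neg_mul, ← pow_add, ← two_mul, pow_mul]
    norm_num
  exact (neg_one_pow_eq_neg_one_iff_odd (by norm_num)).mp h2

/-- **`Δ_W > 0 ⇒ ord₂ C(Wd) + ord₂ C(W)` is EVEN** (the bit count is even: no transposition prime, or two), for any `C(W)`.
[cite: Kramer1981, §2 Prop. 3] [cite: IrelandRosen1990, Prop. 5.2.2] -/
theorem even_padicValNat_add_of_Δ_pos (hK : IsImaginaryQuadratic K)
    (hodd : Odd (NumberField.discr K)) (hH : SatisfiesHeegnerHypothesis (W.conductorNorm ℤ) K) (hΔ : 0 < W.Δ)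
    {Wd : WeierstrassCurve ℚ} [Wd.IsElliptic] (Cd : VariableChange ℚ)
    (hWd : Cd • W.quadraticTwist (NumberField.discr K : ℚ) = Wd) :
    Even (padicValNat 2 Wd.tamagawaProduct + padicValNat 2 W.tamagawaProduct) := by
  have h := neg_one_pow_padicValNat_two_tamagawaProduct_twin_eq_mul_sign W hK hodd hH Cd hWd
  have hs : (minimalDiscriminantInt W).sign = 1 := by
    rw [Int.sign_eq_one_iff_pos, ← @Int.cast_pos ℚ, cast_minimalDiscriminantInt]
    exact hΔ
  rw [hs, mul_one] at h
  have h2 : (-1 : ℤ) ^ (padicValNat 2 Wd.tamagawaProduct + padicValNat 2 W.tamagawaProduct) = 1 := by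
    rw [pow_add, h, ← pow_add, ← two_mul, pow_mul]
    norm_num
  exact (neg_one_pow_eq_one_iff_even (by norm_num)).mp h2

/-- **No all-silent Heegner twin on `Δ < 0`**: `ord₂ C(Wd) ≠ ord₂ C(W)` — the all-silent swapped engine (`…SwappedPairSilent`) fires only on
`Δ > 0`.  [cite: Kramer1981, §2 Prop. 3] -/
theorem padicValNat_twin_ne_of_Δ_neg (hK : IsImaginaryQuadratic K)
    (hodd : Odd (NumberField.discr K)) (hH : SatisfiesHeegnerHypothesis (W.conductorNorm ℤ) K) (hΔ : W.Δ < 0)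
    {Wd : WeierstrassCurve ℚ} [Wd.IsElliptic] (Cd : VariableChange ℚ)
    (hWd : Cd • W.quadraticTwist (NumberField.discr K : ℚ) = Wd) :
    padicValNat 2 Wd.tamagawaProduct ≠ padicValNat 2 W.tamagawaProduct := by
  intro heq
  obtain ⟨k, hk⟩ := odd_padicValNat_add_of_Δ_neg W hK hodd hH hΔ Cd hWd
  omega

/-- **No one-bit Heegner twin on `Δ > 0`**: `ord₂ C(Wd) ≠ ord₂ C(W) + 1` — the one-bit swapped engine (`…SwappedPairOneBit`) fires only on
`Δ < 0`.  [cite: Kramer1981, §2 Prop. 3] -/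
theorem padicValNat_twin_ne_succ_of_Δ_pos (hK : IsImaginaryQuadratic K)
    (hodd : Odd (NumberField.discr K)) (hH : SatisfiesHeegnerHypothesis (W.conductorNorm ℤ) K) (hΔ : 0 < W.Δ)
    {Wd : WeierstrassCurve ℚ} [Wd.IsElliptic] (Cd : VariableChange ℚ)
    (hWd : Cd • W.quadraticTwist (NumberField.discr K : ℚ) = Wd) :
    padicValNat 2 Wd.tamagawaProduct ≠ padicValNat 2 W.tamagawaProduct + 1 := by
  intro heq
  obtain ⟨k, hk⟩ := even_padicValNat_add_of_Δ_pos W hK hodd hH hΔ Cd hWd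
  omega

end Summit.BirchSwinnertonDyer.BirchSwinnertonDyer.Theorems.GenusExact.PlusDescent.BudgetParity

end
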